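import Summits.ResolutionOfSingularities.ResolutionOfSingularities.Theorems.EquisingularLiftEquisingularLiftNatIsoHypPointOfPointsLinAut
import Summits.ResolutionOfSingularities.ResolutionOfSingularities.Theorems.EquisingularLiftEquisingularLiftNatVertexNotRegular
import Summits.ResolutionOfSingularities.ResolutionOfSingularities.Theorems.EquisingularLiftEquisingularLiftNatFirstOrderStrictTransform
import HarnessLib

/-!
# [OURS] ★★★ SINGULAR ONE-STEP POINTS IN ARBITRARY POSITION ⟹ `IsoHypPoint`, with the stalk hypothesis discharged
# (cruxes `Theses.EquisingularLift.EquisingularLiftNat` / `…NatThree`, stmt-ResolutionOfSingularities-20038 / -20148)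

[OURS · leafhand-res-equisingularlift-10 g0, 2026-08-31; cell `pub/decomp-res`] AI-produced, weaker than expert review; NOT a statement of any manuscript; nothing
here proves resolution of singularities in positive characteristic.  DEF-FREE helper; no `sorry`; standard axioms; ZERO named hypotheses.

Capstone of this hand's bridge to the lead's hypothesis #7 (`IsoHypPoint` = `PointResolvable`, the downstairs point-blow-up chain of the registered isolated
residual stub): ✓ `isoHypPoint_of_oneStepPoints_linAut` (p829617) asked, besides the per-point ONE-STEP data in per-point linear coordinates, that `V₊(F)` be
non-regular at each listed point.  Here that is DERIVED from multiplicity `μ ≥ 2` of the moved chart (✓ `not_isRegularLocalRing_stalk_vertex`, p829727),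
transported along `V₊(F) ≅ V₊(linSubst ↑g⁻¹ F)`:

* `exists_iso_hypersurface_linSubst` — **`V₊(F) ≅ V₊(linSubst ↑g⁻¹ F)` over `α_g`** (two reduced closed immersions with the same image; `IsClosedImmersion.lift`);
* ★★ `not_isRegularLocalRing_stalk_linAutPoint` — the point `α_g⁻¹(P_c)` of `V₊(F)` is NOT regular when the moved chart at `P_c` has multiplicity `≥ 2`;
* ★★★ `isoHypPoint_of_singularOneStepPoints_linAut` — **`F` a prime form over `K = K̄`; finitely many points, each with linear coordinates `(g, c)` in which the
  moved equation is a prime form carrying seat res-D-pv-013's ONE-STEP datum of multiplicity `μ ≥ 2`; `V₊(F)` regular elsewhere ⟹ `IsoHypPoint K (m+2) V₊(F) ι`.**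
  ANY number of points, ANY position: e.g. every surface in `ℙ³_k̄` of any degree whose singularities are ordinary multiple points / `A₂` / first-order points
  (their `G_l` by ✓ `FirstOrderPoint.exists_strictTransform`), once the per-point charts are written down — the lh7–lh9 families without «≤ 4 points in general
  position», landing BY NAME on the registered stub's excluded hypothesis.

Remaining classical brick (unchanged): «regular elsewhere» from the closed-point Jacobian criterion for arbitrary closed points (vertex-keyed form in tree:
✓ `MultiOrd.isRegularLocalRing_stalk_of_forall_exists`).  Honest label: closes no registered stub.

References: [Hartshorne1977, I Thm. 5.1, II Example 7.1.1]; [Matsumura1987, Thm. 14.2]; [StacksProject, Tag 080E] — through the cited tree files.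
-/

set_option linter.dupNamespace false -- mandated namespace `Summit.<Summit>.<Problem>` of this single-conjunct summit

noncomputable section

open CategoryTheory CategoryTheory.Limits AlgebraicGeometry TopologicalSpace
open MvPolynomial HomogeneousLocalization
open Literature.AlgebraicGeometry.Resolution Literature.AlgebraicGeometry.Motives Literature.AlgebraicGeometry.GroupSchemes
open Literature.AlgebraicGeometry.Motives.SmoothHypersurface Literature.AlgebraicGeometry.Motives.ProjectiveSpace
open AlgebraicGeometry.Scheme.IdealSheafData
open Summit.ResolutionOfSingularities.ResolutionOfSingularities.Cruxes.EquisingularLift.StrataSplit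

namespace Summit.ResolutionOfSingularities.ResolutionOfSingularities.Cruxes.EquisingularLiftNat.Sections

/-- **`V₊(F) ≅ V₊(linSubst ↑g⁻¹ F)` over the linear automorphism `α_g`**: two reduced closed immersions with the same image. [cite: Hartshorne1977, II Example 7.1.1] -/
theorem exists_iso_hypersurface_linSubst (K : Type) [Field K] {m : ℕ} (F : MvPolynomial (Fin (m + 2 + 1)) K) {d : ℕ} (hF : F.IsHomogeneous d)
    (hFp : Prime F) (g : GL (Fin (m + 2 + 1)) K)
    (hF' : (ProjLinAction.linSubst K ((g⁻¹ : GL (Fin (m + 2 + 1)) K) : Matrix (Fin (m + 2 + 1)) (Fin (m + 2 + 1)) K) F).IsHomogeneous d)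
    (hF'p : Prime (ProjLinAction.linSubst K ((g⁻¹ : GL (Fin (m + 2 + 1)) K) : Matrix (Fin (m + 2 + 1)) (Fin (m + 2 + 1)) K) F)) :
    letI := MvPolynomial.gradedAlgebra (σ := Fin (m + 2 + 1)) (R := K)
    ∃ e : (hypersurface F).left ≅ (hypersurface (ProjLinAction.linSubst K ((g⁻¹ : GL (Fin (m + 2 + 1)) K) : Matrix (Fin (m + 2 + 1)) (Fin (m + 2 + 1)) K) F)).left,
      e.hom ≫ (hypersurfaceι (ProjLinAction.linSubst K ((g⁻¹ : GL (Fin (m + 2 + 1)) K) : Matrix (Fin (m + 2 + 1)) (Fin (m + 2 + 1)) K) F)).left =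
        (hypersurfaceι F).left ≫ (ProjLinAction.projectiveSpaceLinAut (m + 2) K g).hom.left := by
  letI := MvPolynomial.gradedAlgebra (σ := Fin (m + 2 + 1)) (R := K)
  set F' := ProjLinAction.linSubst K ((g⁻¹ : GL (Fin (m + 2 + 1)) K) : Matrix (Fin (m + 2 + 1)) (Fin (m + 2 + 1)) K) F with hF'def
  haveI := HypersurfaceSpecimen.isIntegral_hypersurface_of_prime K F hF hFp
  haveI := HypersurfaceSpecimen.isIntegral_hypersurface_of_prime K F' hF' hF'p
  set ι' : (hypersurface F).left ⟶ (projectiveSpace (m + 2) K).left :=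
    (hypersurfaceι F).left ≫ (ProjLinAction.projectiveSpaceLinAut (m + 2) K g).hom.left with hι'
  haveI : IsClosedImmersion ι' := by rw [hι']; infer_instance
  have hrange' : Set.range ι' = Set.range (hypersurfaceι F').left := by
    rw [hι', QuadricELNat.range_comp_projectiveSpaceLinAut g _ F (range_hypersurfaceι_setOf K F), range_hypersurfaceι_setOf K F']
  have hker : (hypersurfaceι F').left.ker = ι'.ker := by
    have h1 : vanishingIdeal (⟨closure (Set.range (hypersurfaceι F').left), isClosed_closure⟩ : Closeds _) = (hypersurfaceι F').left.ker := by
      rw [← Scheme.IdealSheafData.map_bot, ← Scheme.nilradical_eq_bot, ← Scheme.IdealSheafData.vanishingIdeal_top,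
        Scheme.IdealSheafData.map_vanishingIdeal]
      congr 1; ext1
      change closure (Set.range _) = closure (_ '' Set.univ); rw [Set.image_univ]
    have h2 : vanishingIdeal (⟨closure (Set.range ι'), isClosed_closure⟩ : Closeds _) = ι'.ker := by
      rw [← Scheme.IdealSheafData.map_bot, ← Scheme.nilradical_eq_bot, ← Scheme.IdealSheafData.vanishingIdeal_top,
        Scheme.IdealSheafData.map_vanishingIdeal]
      congr 1; ext1
      change closure (Set.range _) = closure (_ '' Set.univ); rw [Set.image_univ]
    rw [← h1, ← h2]
    congr 2
    rw [hrange']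
  let e : (hypersurface F).left ⟶ (hypersurface F').left := IsClosedImmersion.lift (hypersurfaceι F').left ι' hker.le
  have he : e ≫ (hypersurfaceι F').left = ι' := IsClosedImmersion.lift_fac _ _ hker.le
  haveI : IsIso e := IsClosedImmersion.isIso_lift _ _ hker
  exact ⟨asIso e, he⟩

/-- ★★ **THE POINT `α_g⁻¹(P_c)` IS SINGULAR when the moved chart has multiplicity `μ ≥ 2`** — the stalk hypothesis of ✓ `isoHypPoint_of_oneStepPoints_linAut`
discharged: ✓ `not_isRegularLocalRing_stalk_vertex` for `F' = linSubst ↑g⁻¹ F`, transported along `V₊(F) ≅ V₊(F')` (`exists_iso_hypersurface_linSubst`).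
[OURS] [cite: Matsumura1987, Thm. 14.2] [cite: Hartshorne1977, II Example 7.1.1] -/
theorem not_isRegularLocalRing_stalk_linAutPoint (K : Type) [Field K] {m : ℕ} (F : MvPolynomial (Fin (m + 2 + 1)) K) {d : ℕ} (hF : F.IsHomogeneous d)
    (hFp : Prime F) (g : GL (Fin (m + 2 + 1)) K) (c : Fin (m + 2 + 1))
    (hF' : (ProjLinAction.linSubst K ((g⁻¹ : GL (Fin (m + 2 + 1)) K) : Matrix (Fin (m + 2 + 1)) (Fin (m + 2 + 1)) K) F).IsHomogeneous d)
    (hF'p : Prime (ProjLinAction.linSubst K ((g⁻¹ : GL (Fin (m + 2 + 1)) K) : Matrix (Fin (m + 2 + 1)) (Fin (m + 2 + 1)) K) F))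
    (hsplit : ∃ (μ : ℕ) (Φ Ψ : MvPolynomial (Fin (m + 2)) K), 2 ≤ μ ∧ Φ.IsHomogeneous μ ∧
      Ψ ∈ Ideal.span (Set.range (X : Fin (m + 2) → MvPolynomial (Fin (m + 2)) K)) ^ (μ + 1) ∧
      ProjectiveSpace.dehomogenize K c (ProjLinAction.linSubst K ((g⁻¹ : GL (Fin (m + 2 + 1)) K) : Matrix (Fin (m + 2 + 1)) (Fin (m + 2 + 1)) K) F) = Φ + Ψ) :
    letI := MvPolynomial.gradedAlgebra (σ := Fin (m + 2 + 1)) (R := K)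
    ∀ x : ↥(hypersurface F).left,
      (∀ a : Fin (m + 2 + 1), a ≠ c → ProjLinAction.linSubst K (g : Matrix (Fin (m + 2 + 1)) (Fin (m + 2 + 1)) K) (X a) ∈ ((hypersurfaceι F).left x).asHomogeneousIdeal) →
      ¬ IsRegularLocalRing ((hypersurface F).left.presheaf.stalk x) := by
  letI := MvPolynomial.gradedAlgebra (σ := Fin (m + 2 + 1)) (R := K)
  intro x hxv hreg
  set F' := ProjLinAction.linSubst K ((g⁻¹ : GL (Fin (m + 2 + 1)) K) : Matrix (Fin (m + 2 + 1)) (Fin (m + 2 + 1)) K) F with hF'def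
  obtain ⟨e, he⟩ := exists_iso_hypersurface_linSubst K F hF hFp g hF' hF'p
  -- the transported point is the vertex point of `V₊(F')`
  have hv : ∀ a : Fin (m + 2 + 1), a ≠ c → (X a : MvPolynomial (Fin (m + 2 + 1)) K) ∈ ((hypersurfaceι F').left (e.hom x)).asHomogeneousIdeal := by
    intro a ha
    rw [← Scheme.Hom.comp_apply, he, Scheme.Hom.comp_apply]
    exact (QuadricELNat.mem_asHomogeneousIdeal_linAut_hom_iff g _ (X a)).mpr (hxv a ha)
  refine not_isRegularLocalRing_stalk_vertex K F' hF' hF'p c hsplit (e.hom x) hv ?_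
  haveI := hreg
  exact IsRegularLocalRing.of_ringEquiv (R := (hypersurface F).left.presheaf.stalk x) (asIso (e.hom.stalkMap x)).commRingCatIsoToRingEquiv.symm

/-- ★★★ **SINGULAR ONE-STEP POINTS IN ARBITRARY POSITION ⟹ `IsoHypPoint`, with no stalk hypothesis** (`K = K̄`): ✓ `isoHypPoint_of_oneStepPoints_linAut` with its
non-regularity hypothesis discharged by `not_isRegularLocalRing_stalk_linAutPoint` (multiplicity `μ ≥ 2` in each moved chart).  `F` a prime form; `pts` a list of
per-point coordinates `(g, c)` whose moved equations `linSubst ↑g⁻¹ F` are prime forms of degree `d` carrying seat res-D-pv-013's ONE-STEP datum of multiplicity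
`μ ≥ 2` at the vertex `P_c`; `V₊(F)` regular at every point which is none of the `α_g⁻¹(P_c)`.  Then `IsoHypPoint K (m+2) V₊(F) ι` (the lead's hypothesis #7, =
`PointResolvable`; `ELNatAt` follows by ✓ `elNatAt_of_isoHypPoint`). [OURS] [cite: Hartshorne1977, I Thm. 5.1, II Example 7.1.1] [cite: StacksProject, Tag 080E] -/
theorem isoHypPoint_of_singularOneStepPoints_linAut (K : Type) [Field K] [IsAlgClosed K] {m : ℕ} (F : MvPolynomial (Fin (m + 2 + 1)) K) {d : ℕ}
    (hF : F.IsHomogeneous d) (hFp : Prime F) (pts : List (GL (Fin (m + 2 + 1)) K × Fin (m + 2 + 1)))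
    (hone : ∀ gc ∈ pts,
      (ProjLinAction.linSubst K ((gc.1⁻¹ : GL (Fin (m + 2 + 1)) K) : Matrix (Fin (m + 2 + 1)) (Fin (m + 2 + 1)) K) F).IsHomogeneous d ∧
      Prime (ProjLinAction.linSubst K ((gc.1⁻¹ : GL (Fin (m + 2 + 1)) K) : Matrix (Fin (m + 2 + 1)) (Fin (m + 2 + 1)) K) F) ∧
      ∃ (μ : ℕ) (Φ Ψ : MvPolynomial (Fin (m + 2)) K), 2 ≤ μ ∧ Φ.IsHomogeneous μ ∧ Φ ≠ 0 ∧
        Ψ ∈ Ideal.span (Set.range (X : Fin (m + 2) → MvPolynomial (Fin (m + 2)) K)) ^ (μ + 1) ∧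
        ProjectiveSpace.dehomogenize K gc.2 (ProjLinAction.linSubst K ((gc.1⁻¹ : GL (Fin (m + 2 + 1)) K) :
          Matrix (Fin (m + 2 + 1)) (Fin (m + 2 + 1)) K) F) = Φ + Ψ ∧
        ∀ l : Fin (m + 2), ∃ G : MvPolynomial (Fin (m + 2)) K,
          aeval (fun j => X l * Function.update (X : Fin (m + 2) → MvPolynomial (Fin (m + 2)) K) l 1 j) (Φ + Ψ) = X l ^ μ * G ∧
          ∀ P : Ideal (MvPolynomial (Fin (m + 2)) K), P.IsPrime → (X l : MvPolynomial (Fin (m + 2)) K) ∈ P → G ∈ P → ∃ j, pderiv j G ∉ P)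
    (hreg : letI := MvPolynomial.gradedAlgebra (σ := Fin (m + 2 + 1)) (R := K)
      ∀ x : ↥(hypersurface F).left, (∀ gc ∈ pts, ¬ (∀ a : Fin (m + 2 + 1), a ≠ gc.2 →
        ProjLinAction.linSubst K (gc.1 : Matrix (Fin (m + 2 + 1)) (Fin (m + 2 + 1)) K) (X a) ∈ ((hypersurfaceι F).left x).asHomogeneousIdeal)) →
        IsRegularLocalRing ((hypersurface F).left.presheaf.stalk x)) :
    letI := MvPolynomial.gradedAlgebra (σ := Fin (m + 2 + 1)) (R := K)
    IsoHypPoint K (m + 2) (hypersurface F).left (hypersurfaceι F).left := by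
  letI := MvPolynomial.gradedAlgebra (σ := Fin (m + 2 + 1)) (R := K)
  refine isoHypPoint_of_oneStepPoints_linAut K F hF hFp pts (fun gc hgc => ?_) (fun gc hgc x hx => ?_) hreg
  · obtain ⟨h1, h2, μ, Φ, Ψ, hμ, hΦ, hΦ0, hΨ, hdeh, hG⟩ := hone gc hgc
    exact ⟨h1, h2, μ, Φ, Ψ, by omega, hΦ, hΦ0, hΨ, hdeh, hG⟩
  · obtain ⟨h1, h2, μ, Φ, Ψ, hμ, hΦ, -, hΨ, hdeh, -⟩ := hone gc hgc
    exact not_isRegularLocalRing_stalk_linAutPoint K F hF hFp gc.1 gc.2 h1 h2 ⟨μ, Φ, Ψ, hμ, hΦ, hΨ, hdeh⟩ x hx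

end Summit.ResolutionOfSingularities.ResolutionOfSingularities.Cruxes.EquisingularLiftNat.Sections

end
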